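import Summits.Ventures.LatticeQCDFlow.Scoring.SchwingerDysonPhi4GibbsMonomial
import HarnessLib

/-!
# Corollaries of the lattice φ⁴ Schwinger–Dyson identity: equation of motion, tower, propagator equation, score identity

HONEST FRAMING: exact (Metropolis-corrected) sampling algorithms for lattice gauge theory;
figures of merit are autocorrelation/cost numbers at stated couplings and volumes; no
continuum-physics claim.  (SCALAR calibration rung S0-A: not a gauge result.)

Venture `LatticeQCDFlow` (cell pub-lqcd), sub-topic `Scoring`; FANOUT row 2 (`s0-phi4`).  NEW WORK
of the cell.  Companion of `SchwingerDysonPhi4GibbsMonomial.lean` (`gibbs_sd_monomial_of_coercive`: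
`⟨(Π φ^k) ∂S/∂φ_x⟩ = k_x ⟨Π φ^{k[x ↦ k_x−1]}⟩` for the Gibbs measure of `S = ΣφJφ + λΣφ⁴` on
`ℝ^{n+1}` under coercivity `εΣφ² − K ≤ S`).  Read off here, first under coercivity
(`…_of_coercive`, any real `λ`, `J`), then discharged for `λ > 0` and any real `J`:

* `gibbs_eom` — **equation of motion** `⟨∂S/∂φ_x⟩ = 0`;
* `gibbs_sd_pow` — **the tower** `⟨φ_x^m ∂S/∂φ_x⟩ = m⟨φ_x^{m−1}⟩` for every `m : ℕ` (`m = 1` is the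
  virial identity `gibbs_virial` of `SchwingerDysonPhi4Gibbs.lean`), and `gibbs_moment_recursion`,
  its moment form `4λ⟨φ_x^{m+3}⟩ + Σ_y (J_{xy}+J_{yx})⟨φ_x^m φ_y⟩ = m⟨φ_x^{m−1}⟩`;
* `gibbs_sd_two_point` — `⟨φ_y ∂S/∂φ_x⟩ = δ_{xy}`, and `gibbs_propagator_sd`, **the Schwinger–Dyson
  equation for the propagator** `Σ_z (J_{xz} + J_{zx}) ⟨φ_z φ_y⟩ + 4λ ⟨φ_x³ φ_y⟩ = δ_{xy}` — the
  exact linear relation between the two-point function and the `φ³–φ` insertion;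
* `gibbs_score` / `gibbs_score_residual` — **the score (second-order Stein) identity under the
  JOINT law** `⟨(∂S/∂φ_x)²⟩ = ⟨∂²S/∂φ_x²⟩ = 2J_{xx} + 12λ⟨φ_x²⟩`; `gibbs_score_shift`: for the
  engine's nearest-neighbour action (latflow.core `phi4_2d`, AKS 2019 eq. (3.35)) on a periodic
  lattice whose shifts fix no site, `J_{xx} = 2d + m²` (`shiftCoupling_diag`), so in `d = 2`
  `⟨2(4 + m²) + 12λφ_x² − F_x²⟩ = 0` — the population statement behind the `obs_sd_score` column
  of latflow.core ≥ 0.2.5 for the joint Gibbs law (row 9's `Exactness/Phi4SiteLaw.phi4_site_score`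
  is the one-site conditional law; `SteinProduct` the abstract Fubini step).

Also the linearity of `gibbsExpect` over integrable densities (`gibbsExpect_add/sub/sum/const`).

NOT here: non-polynomial observables; statistical power of the columns (numerics gate); the
Gaussian `λ = 0` discharge and the free propagator `G = (J + Jᵀ)⁻¹` (next file).
-/

namespace Summit.Ventures.LatticeQCDFlow.Scoring

open Real MeasureTheory Set Filter Finset

section Polynomial

variable {n : ℕ}

/-! ## Linearity of the Gibbs expectation -/

/-- `⟨c⟩ = c` whenever `Z > 0`. -/
theorem gibbsExpect_const {J : Fin (n + 1) → Fin (n + 1) → ℝ} {lam : ℝ} (hZ : 0 < gibbsZ J lam)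
    (c : ℝ) : gibbsExpect J lam (fun _ => c) = c := by
  unfold gibbsExpect
  rw [integral_const_mul]
  unfold gibbsZ at hZ ⊢
  field_simp

/-- `⟨c f⟩ = c ⟨f⟩`. -/
theorem gibbsExpect_const_mul (J : Fin (n + 1) → Fin (n + 1) → ℝ) (lam c : ℝ)
    (f : (Fin (n + 1) → ℝ) → ℝ) :
    gibbsExpect J lam (fun φ => c * f φ) = c * gibbsExpect J lam f := by
  unfold gibbsExpect
  simp only [mul_assoc]
  rw [integral_const_mul, mul_div_assoc]

/-- `⟨f + g⟩ = ⟨f⟩ + ⟨g⟩` for integrable densities. -/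
theorem gibbsExpect_add (J : Fin (n + 1) → Fin (n + 1) → ℝ) (lam : ℝ)
    {f g : (Fin (n + 1) → ℝ) → ℝ}
    (hf : Integrable (fun φ => f φ * gibbsWeight J lam φ))
    (hg : Integrable (fun φ => g φ * gibbsWeight J lam φ)) :
    gibbsExpect J lam (fun φ => f φ + g φ) = gibbsExpect J lam f + gibbsExpect J lam g := by
  unfold gibbsExpect
  simp only [add_mul]
  rw [integral_add hf hg, add_div]

/-- `⟨f − g⟩ = ⟨f⟩ − ⟨g⟩` for integrable densities. -/
theorem gibbsExpect_sub (J : Fin (n + 1) → Fin (n + 1) → ℝ) (lam : ℝ)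
    {f g : (Fin (n + 1) → ℝ) → ℝ}
    (hf : Integrable (fun φ => f φ * gibbsWeight J lam φ))
    (hg : Integrable (fun φ => g φ * gibbsWeight J lam φ)) :
    gibbsExpect J lam (fun φ => f φ - g φ) = gibbsExpect J lam f - gibbsExpect J lam g := by
  unfold gibbsExpect
  simp only [sub_mul]
  rw [integral_sub hf hg, sub_div]

/-- `⟨Σ_i f_i⟩ = Σ_i ⟨f_i⟩` for integrable densities. -/
theorem gibbsExpect_sum (J : Fin (n + 1) → Fin (n + 1) → ℝ) (lam : ℝ) {ι : Type*}
    (s : Finset ι) {f : ι → (Fin (n + 1) → ℝ) → ℝ}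
    (hf : ∀ i ∈ s, Integrable (fun φ => f i φ * gibbsWeight J lam φ)) :
    gibbsExpect J lam (fun φ => ∑ i ∈ s, f i φ) = ∑ i ∈ s, gibbsExpect J lam (f i) := by
  unfold gibbsExpect
  simp only [Finset.sum_mul]
  rw [integral_finsetSum s hf, Finset.sum_div]

/-! ## Corollaries under coercivity (any real `λ`, `J` with `εΣφ² − K ≤ S`) -/

/-- **Equation of motion** (`k = 0`): `⟨∂S/∂φ_x⟩ = 0`. -/
theorem gibbs_eom_of_coercive {J : Fin (n + 1) → Fin (n + 1) → ℝ} {lam ε K : ℝ} (hε : 0 < ε)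
    (hS : ∀ φ : Fin (n + 1) → ℝ, ε * ∑ w, φ w ^ 2 - K ≤ latticePhi4Action J lam φ)
    (x : Fin (n + 1)) :
    gibbsExpect J lam (fun φ => latticePhi4Force J lam φ x) = 0 := by
  have h := gibbs_sd_monomial_of_coercive hε hS (fun _ => 0) x
  have e : (fun φ : Fin (n + 1) → ℝ =>
      (∏ w, φ w ^ (fun _ => (0 : ℕ)) w) * latticePhi4Force J lam φ x)
      = fun φ => latticePhi4Force J lam φ x := by
    funext φ
    simp
  rw [e] at h
  simpa using h

/-- **The tower** (`k = m·δ_x`): `⟨φ_x^m ∂S/∂φ_x⟩ = m ⟨φ_x^{m−1}⟩` for every `m : ℕ`. -/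
theorem gibbs_sd_pow_of_coercive {J : Fin (n + 1) → Fin (n + 1) → ℝ} {lam ε K : ℝ} (hε : 0 < ε)
    (hS : ∀ φ : Fin (n + 1) → ℝ, ε * ∑ w, φ w ^ 2 - K ≤ latticePhi4Action J lam φ)
    (x : Fin (n + 1)) (m : ℕ) :
    gibbsExpect J lam (fun φ => φ x ^ m * latticePhi4Force J lam φ x)
      = m * gibbsExpect J lam (fun φ => φ x ^ (m - 1)) := by
  have h := gibbs_sd_monomial_of_coercive hε hS (Function.update (fun _ => 0) x m) x
  have e1 : (fun φ : Fin (n + 1) → ℝ =>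
      (∏ w, φ w ^ Function.update (fun _ => (0 : ℕ)) x m w) * latticePhi4Force J lam φ x)
      = fun φ => φ x ^ m * latticePhi4Force J lam φ x := by
    funext φ
    rw [prod_pow_single]
  have e2 : (fun φ : Fin (n + 1) → ℝ =>
      ∏ w, φ w ^ Function.update (Function.update (fun _ => (0 : ℕ)) x m) x
        (Function.update (fun _ => (0 : ℕ)) x m x - 1) w)
      = fun φ => φ x ^ (m - 1) := by
    funext φ
    rw [Function.update_idem, Function.update_self, prod_pow_single]
  rw [e1, e2, Function.update_self] at h
  exact h

/-- Distinct sites (`k = δ_y`, `y ≠ x`): `⟨φ_y ∂S/∂φ_x⟩ = 0`. -/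
theorem gibbs_sd_offDiag_of_coercive {J : Fin (n + 1) → Fin (n + 1) → ℝ} {lam ε K : ℝ}
    (hε : 0 < ε) (hS : ∀ φ : Fin (n + 1) → ℝ, ε * ∑ w, φ w ^ 2 - K ≤ latticePhi4Action J lam φ)
    {x y : Fin (n + 1)} (hxy : y ≠ x) :
    gibbsExpect J lam (fun φ => φ y * latticePhi4Force J lam φ x) = 0 := by
  have h := gibbs_sd_monomial_of_coercive hε hS (Function.update (fun _ => 0) y 1) x
  have e1 : (fun φ : Fin (n + 1) → ℝ =>
      (∏ w, φ w ^ Function.update (fun _ => (0 : ℕ)) y 1 w) * latticePhi4Force J lam φ x)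
      = fun φ => φ y * latticePhi4Force J lam φ x := by
    funext φ
    rw [prod_pow_single, pow_one]
  have hkx : Function.update (fun _ => (0 : ℕ)) y 1 x = 0 := by
    rw [Function.update_of_ne hxy.symm]
  rw [e1, hkx] at h
  simpa using h

/-- **`⟨φ_y ∂S/∂φ_x⟩ = δ_{xy}`** for all sites (the `m = 1` tower on the diagonal). -/
theorem gibbs_sd_two_point_of_coercive {J : Fin (n + 1) → Fin (n + 1) → ℝ} {lam ε K : ℝ}
    (hε : 0 < ε) (hS : ∀ φ : Fin (n + 1) → ℝ, ε * ∑ w, φ w ^ 2 - K ≤ latticePhi4Action J lam φ)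
    (x y : Fin (n + 1)) :
    gibbsExpect J lam (fun φ => φ y * latticePhi4Force J lam φ x) = if y = x then 1 else 0 := by
  by_cases hxy : y = x
  · rw [if_pos hxy, hxy]
    have h := gibbs_sd_pow_of_coercive hε hS x 1
    simp only [pow_one, Nat.cast_one, one_mul, Nat.sub_self, pow_zero] at h
    rw [h]
    exact gibbsExpect_const (gibbsZ_pos_of_coercive hε hS) 1
  · rw [if_neg hxy]
    exact gibbs_sd_offDiag_of_coercive hε hS hxy

/-- **The Schwinger–Dyson equation for the propagator**, under coercivity:
`Σ_z (J_{xz} + J_{zx}) ⟨φ_z φ_y⟩ + 4λ ⟨φ_x³ φ_y⟩ = δ_{xy}`. -/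
theorem gibbs_propagator_sd_of_coercive {J : Fin (n + 1) → Fin (n + 1) → ℝ} {lam ε K : ℝ}
    (hε : 0 < ε) (hS : ∀ φ : Fin (n + 1) → ℝ, ε * ∑ w, φ w ^ 2 - K ≤ latticePhi4Action J lam φ)
    (x y : Fin (n + 1)) :
    (∑ z, (J x z + J z x) * gibbsExpect J lam (fun φ => φ z * φ y))
        + 4 * lam * gibbsExpect J lam (fun φ => φ x ^ 3 * φ y)
      = if y = x then 1 else 0 := by
  rw [← gibbs_sd_two_point_of_coercive hε hS x y]
  have hI := fun z a => integrable_pow_mul_pow_mul_gibbsWeight_of_coercive hε hS z y a 1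
  have e : (fun φ : Fin (n + 1) → ℝ => φ y * latticePhi4Force J lam φ x)
      = fun φ => (∑ z, (J x z + J z x) * (φ z * φ y)) + 4 * lam * (φ x ^ 3 * φ y) := by
    funext φ
    unfold latticePhi4Force
    rw [mul_add, Finset.mul_sum]
    congr 1
    · exact Finset.sum_congr rfl fun z _ => by ring
    · ring
  rw [e, gibbsExpect_add, gibbsExpect_sum, gibbsExpect_const_mul]
  · simp only [gibbsExpect_const_mul]
  · intro z _
    refine ((hI z 1).const_mul (J x z + J z x)).congr (Eventually.of_forall fun φ => ?_)
    simp only [pow_one]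
    ring
  · refine (integrable_finsetSum Finset.univ fun z (_ : z ∈ Finset.univ) =>
      ((hI z 1).const_mul (J x z + J z x))).congr (Eventually.of_forall fun φ => ?_)
    simp only [Finset.sum_mul, pow_one]
    exact Finset.sum_congr rfl fun z _ => by ring
  · refine ((hI x 3).const_mul (4 * lam)).congr (Eventually.of_forall fun φ => ?_)
    simp only [pow_one]
    ring

/-- **Moment form of the tower**, under coercivity:
`4λ ⟨φ_x^{m+3}⟩ + Σ_y (J_{xy} + J_{yx}) ⟨φ_x^m φ_y⟩ = m ⟨φ_x^{m−1}⟩` (the one-site recursion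
`phi4SiteMoment_recursion` under the joint law, the linear coefficient replaced by the neighbour
insertion). -/
theorem gibbs_moment_recursion_of_coercive {J : Fin (n + 1) → Fin (n + 1) → ℝ} {lam ε K : ℝ}
    (hε : 0 < ε) (hS : ∀ φ : Fin (n + 1) → ℝ, ε * ∑ w, φ w ^ 2 - K ≤ latticePhi4Action J lam φ)
    (x : Fin (n + 1)) (m : ℕ) :
    4 * lam * gibbsExpect J lam (fun φ => φ x ^ (m + 3))
        + ∑ y, (J x y + J y x) * gibbsExpect J lam (fun φ => φ x ^ m * φ y)
      = m * gibbsExpect J lam (fun φ => φ x ^ (m - 1)) := by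
  rw [← gibbs_sd_pow_of_coercive hε hS x m]
  have hI := fun y a b => integrable_pow_mul_pow_mul_gibbsWeight_of_coercive hε hS x y a b
  have e : (fun φ : Fin (n + 1) → ℝ => φ x ^ m * latticePhi4Force J lam φ x)
      = fun φ => 4 * lam * φ x ^ (m + 3) + ∑ y, (J x y + J y x) * (φ x ^ m * φ y) := by
    funext φ
    unfold latticePhi4Force
    rw [mul_add, Finset.mul_sum, add_comm]
    congr 1
    · ring
    · exact Finset.sum_congr rfl fun y _ => by ring
  rw [e, gibbsExpect_add, gibbsExpect_sum, gibbsExpect_const_mul]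
  · simp only [gibbsExpect_const_mul]
  · intro y _
    refine ((hI y m 1).const_mul (J x y + J y x)).congr (Eventually.of_forall fun φ => ?_)
    simp only [pow_one]
    ring
  · refine ((hI x (m + 3) 0).const_mul (4 * lam)).congr (Eventually.of_forall fun φ => ?_)
    simp only [pow_zero, mul_one]
    ring
  · refine (integrable_finsetSum Finset.univ fun y (_ : y ∈ Finset.univ) =>
      ((hI y m 1).const_mul (J x y + J y x))).congr (Eventually.of_forall fun φ => ?_)
    simp only [Finset.sum_mul, pow_one]
    exact Finset.sum_congr rfl fun y _ => by ring

/-- Expansion of the squared force: `F_x² = Σ_y (J_{xy} + J_{yx}) (φ_y F_x) + 4λ (φ_x³ F_x)`. -/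
theorem latticePhi4Force_sq (J : Fin (n + 1) → Fin (n + 1) → ℝ) (lam : ℝ) (φ : Fin (n + 1) → ℝ)
    (x : Fin (n + 1)) :
    latticePhi4Force J lam φ x ^ 2
      = (∑ y, (J x y + J y x) * (φ y * latticePhi4Force J lam φ x))
        + 4 * lam * (φ x ^ 3 * latticePhi4Force J lam φ x) := by
  have hF : latticePhi4Force J lam φ x = (∑ y, (J x y + J y x) * φ y) + 4 * lam * φ x ^ 3 := rfl
  calc latticePhi4Force J lam φ x ^ 2
      = ((∑ y, (J x y + J y x) * φ y) + 4 * lam * φ x ^ 3) * latticePhi4Force J lam φ x := by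
        rw [sq, ← hF]
    _ = (∑ y, (J x y + J y x) * (φ y * latticePhi4Force J lam φ x))
          + 4 * lam * (φ x ^ 3 * latticePhi4Force J lam φ x) := by
        rw [add_mul, Finset.sum_mul]
        congr 1
        · exact Finset.sum_congr rfl fun y _ => by ring
        · ring

/-- **The lattice score identity under coercivity**: `⟨(∂S/∂φ_x)²⟩ = 2 J_{xx} + 12λ ⟨φ_x²⟩`
(`= ⟨∂²S/∂φ_x²⟩`).  Proof: `F_x² = Σ_y (J_{xy} + J_{yx}) φ_y F_x + 4λ φ_x³ F_x`, then
`⟨φ_y F_x⟩ = δ_{xy}` and the `m = 3` tower. -/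
theorem gibbs_score_of_coercive {J : Fin (n + 1) → Fin (n + 1) → ℝ} {lam ε K : ℝ}
    (hε : 0 < ε) (hS : ∀ φ : Fin (n + 1) → ℝ, ε * ∑ w, φ w ^ 2 - K ≤ latticePhi4Action J lam φ)
    (x : Fin (n + 1)) :
    gibbsExpect J lam (fun φ => latticePhi4Force J lam φ x ^ 2)
      = 2 * J x x + 12 * lam * gibbsExpect J lam (fun φ => φ x ^ 2) := by
  have hI := fun y a =>
    integrable_pow_mul_pow_mul_force_mul_gibbsWeight_of_coercive hε hS y y x a 0
  have e : (fun φ : Fin (n + 1) → ℝ => latticePhi4Force J lam φ x ^ 2)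
      = fun φ => (∑ y, (J x y + J y x) * (φ y * latticePhi4Force J lam φ x))
          + 4 * lam * (φ x ^ 3 * latticePhi4Force J lam φ x) := by
    funext φ
    exact latticePhi4Force_sq J lam φ x
  rw [e, gibbsExpect_add, gibbsExpect_sum, gibbsExpect_const_mul, gibbs_sd_pow_of_coercive hε hS x 3]
  · simp only [gibbsExpect_const_mul, gibbs_sd_two_point_of_coercive hε hS]
    simp only [mul_ite, mul_one, mul_zero, Finset.sum_ite_eq', Finset.mem_univ, if_true]
    push_cast
    ring
  · intro y _
    refine ((hI y 1).const_mul (J x y + J y x)).congr (Eventually.of_forall fun φ => ?_)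
    simp only [pow_one, pow_zero, mul_one]
    ring
  · refine (integrable_finsetSum Finset.univ fun y (_ : y ∈ Finset.univ) =>
      ((hI y 1).const_mul (J x y + J y x))).congr (Eventually.of_forall fun φ => ?_)
    simp only [Finset.sum_mul, pow_one, pow_zero, mul_one]
    exact Finset.sum_congr rfl fun y _ => by ring
  · refine ((hI x 3).const_mul (4 * lam)).congr (Eventually.of_forall fun φ => ?_)
    simp only [pow_zero, mul_one]
    ring

/-- Integrability of `F_x² e^{−S}` under coercivity. -/
theorem integrable_force_sq_mul_gibbsWeight_of_coercive {J : Fin (n + 1) → Fin (n + 1) → ℝ}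
    {lam ε K : ℝ} (hε : 0 < ε)
    (hS : ∀ φ : Fin (n + 1) → ℝ, ε * ∑ w, φ w ^ 2 - K ≤ latticePhi4Action J lam φ)
    (x : Fin (n + 1)) :
    Integrable (fun φ : Fin (n + 1) → ℝ => latticePhi4Force J lam φ x ^ 2 * gibbsWeight J lam φ) := by
  have hI := fun y a =>
    integrable_pow_mul_pow_mul_force_mul_gibbsWeight_of_coercive hε hS y y x a 0
  refine ((integrable_finsetSum Finset.univ fun y (_ : y ∈ Finset.univ) =>
    (hI y 1).const_mul (J x y + J y x)).add ((hI x 3).const_mul (4 * lam))).congr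
    (Eventually.of_forall fun φ => ?_)
  simp only [Pi.add_apply, pow_one, pow_zero, mul_one]
  rw [latticePhi4Force_sq, add_mul, Finset.sum_mul]
  congr 1
  · exact Finset.sum_congr rfl fun y _ => by ring
  · ring

/-- **Score residual form under coercivity**: `⟨2 J_{xx} + 12λ φ_x² − (∂S/∂φ_x)²⟩ = 0`. -/
theorem gibbs_score_residual_of_coercive {J : Fin (n + 1) → Fin (n + 1) → ℝ} {lam ε K : ℝ}
    (hε : 0 < ε) (hS : ∀ φ : Fin (n + 1) → ℝ, ε * ∑ w, φ w ^ 2 - K ≤ latticePhi4Action J lam φ)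
    (x : Fin (n + 1)) :
    gibbsExpect J lam (fun φ => 2 * J x x + 12 * lam * φ x ^ 2 - latticePhi4Force J lam φ x ^ 2)
      = 0 := by
  have hZ := gibbsZ_pos_of_coercive hε hS
  have hIc : Integrable (fun φ : Fin (n + 1) → ℝ => 2 * J x x * gibbsWeight J lam φ) :=
    (integrable_gibbsWeight_of_coercive hε hS).const_mul _
  have hI2 : Integrable (fun φ : Fin (n + 1) → ℝ => 12 * lam * φ x ^ 2 * gibbsWeight J lam φ) := by
    refine ((integrable_pow_mul_pow_mul_gibbsWeight_of_coercive hε hS x x 2 0).const_mul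
      (12 * lam)).congr (Eventually.of_forall fun φ => ?_)
    simp only [pow_zero, mul_one]
    ring
  have hIc2 : Integrable (fun φ : Fin (n + 1) → ℝ =>
      (2 * J x x + 12 * lam * φ x ^ 2) * gibbsWeight J lam φ) := by
    refine (hIc.add hI2).congr (Eventually.of_forall fun φ => ?_)
    simp only [Pi.add_apply]
    ring
  rw [gibbsExpect_sub J lam hIc2 (integrable_force_sq_mul_gibbsWeight_of_coercive hε hS x),
    gibbsExpect_add J lam hIc hI2, gibbsExpect_const hZ, gibbsExpect_const_mul,
    gibbs_score_of_coercive hε hS]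
  ring

/-! ## The identities for `λ > 0` (any real `J`, incl. the tachyonic AKS 2019 sets) -/

/-- **Equation of motion** `⟨∂S/∂φ_x⟩ = 0` (`λ > 0`, any `J`, every site). -/
theorem gibbs_eom {lam : ℝ} (hlam : 0 < lam) (J : Fin (n + 1) → Fin (n + 1) → ℝ)
    (x : Fin (n + 1)) :
    gibbsExpect J lam (fun φ => latticePhi4Force J lam φ x) = 0 :=
  gibbs_eom_of_coercive one_pos (latticePhi4Action_coercive hlam J) x

/-- **The tower** `⟨φ_x^m ∂S/∂φ_x⟩ = m ⟨φ_x^{m−1}⟩` for every `m : ℕ` (`λ > 0`, any `J`). -/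
theorem gibbs_sd_pow {lam : ℝ} (hlam : 0 < lam) (J : Fin (n + 1) → Fin (n + 1) → ℝ)
    (x : Fin (n + 1)) (m : ℕ) :
    gibbsExpect J lam (fun φ => φ x ^ m * latticePhi4Force J lam φ x)
      = m * gibbsExpect J lam (fun φ => φ x ^ (m - 1)) :=
  gibbs_sd_pow_of_coercive one_pos (latticePhi4Action_coercive hlam J) x m

/-- **Moment recursion** `4λ⟨φ_x^{m+3}⟩ + Σ_y (J_{xy} + J_{yx})⟨φ_x^m φ_y⟩ = m⟨φ_x^{m−1}⟩`
(`λ > 0`, any `J`). -/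
theorem gibbs_moment_recursion {lam : ℝ} (hlam : 0 < lam) (J : Fin (n + 1) → Fin (n + 1) → ℝ)
    (x : Fin (n + 1)) (m : ℕ) :
    4 * lam * gibbsExpect J lam (fun φ => φ x ^ (m + 3))
        + ∑ y, (J x y + J y x) * gibbsExpect J lam (fun φ => φ x ^ m * φ y)
      = m * gibbsExpect J lam (fun φ => φ x ^ (m - 1)) :=
  gibbs_moment_recursion_of_coercive one_pos (latticePhi4Action_coercive hlam J) x m

/-- **`⟨φ_y ∂S/∂φ_x⟩ = δ_{xy}`** (`λ > 0`, any `J`). -/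
theorem gibbs_sd_two_point {lam : ℝ} (hlam : 0 < lam) (J : Fin (n + 1) → Fin (n + 1) → ℝ)
    (x y : Fin (n + 1)) :
    gibbsExpect J lam (fun φ => φ y * latticePhi4Force J lam φ x) = if y = x then 1 else 0 :=
  gibbs_sd_two_point_of_coercive one_pos (latticePhi4Action_coercive hlam J) x y

/-- **The Schwinger–Dyson equation for the propagator** (`λ > 0`, any real `J`):
`Σ_z (J_{xz} + J_{zx}) ⟨φ_z φ_y⟩ + 4λ ⟨φ_x³ φ_y⟩ = δ_{xy}` for all sites `x, y`. -/
theorem gibbs_propagator_sd {lam : ℝ} (hlam : 0 < lam) (J : Fin (n + 1) → Fin (n + 1) → ℝ)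
    (x y : Fin (n + 1)) :
    (∑ z, (J x z + J z x) * gibbsExpect J lam (fun φ => φ z * φ y))
        + 4 * lam * gibbsExpect J lam (fun φ => φ x ^ 3 * φ y)
      = if y = x then 1 else 0 :=
  gibbs_propagator_sd_of_coercive one_pos (latticePhi4Action_coercive hlam J) x y

/-- **The lattice score identity** `⟨(∂S/∂φ_x)²⟩ = 2 J_{xx} + 12λ ⟨φ_x²⟩` (`λ > 0`, any `J`). -/
theorem gibbs_score {lam : ℝ} (hlam : 0 < lam) (J : Fin (n + 1) → Fin (n + 1) → ℝ)
    (x : Fin (n + 1)) :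
    gibbsExpect J lam (fun φ => latticePhi4Force J lam φ x ^ 2)
      = 2 * J x x + 12 * lam * gibbsExpect J lam (fun φ => φ x ^ 2) :=
  gibbs_score_of_coercive one_pos (latticePhi4Action_coercive hlam J) x

/-- **Score residual**: `⟨2 J_{xx} + 12λ φ_x² − (∂S/∂φ_x)²⟩ = 0` (`λ > 0`, any `J`). -/
theorem gibbs_score_residual {lam : ℝ} (hlam : 0 < lam) (J : Fin (n + 1) → Fin (n + 1) → ℝ)
    (x : Fin (n + 1)) :
    gibbsExpect J lam (fun φ => 2 * J x x + 12 * lam * φ x ^ 2 - latticePhi4Force J lam φ x ^ 2)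
      = 0 :=
  gibbs_score_residual_of_coercive one_pos (latticePhi4Action_coercive hlam J) x

/-! ## The engine's action: `J_{xx} = 2d + m²` -/

/-- **Score identity for the engine's nearest-neighbour action** (latflow.core `phi4_2d`, AKS 2019
eq. (3.35)) on an enumerated periodic lattice `Fin (n+1)` with shift bijections `σ_μ`, `μ : ι`
(`d = |ι|` directions), none of which fixes the site `x` (every extent `L_μ ≥ 2`), `λ > 0`:
`⟨(∂S/∂φ_x)²⟩ = 2(2d + m²) + 12λ⟨φ_x²⟩`; in `d = 2` the population statement
`⟨2(4 + m²) + 12λφ_x² − F_x²⟩ = 0` behind the `obs_sd_score` column, for the joint Gibbs law. -/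
theorem gibbs_score_shift {ι : Type*} [Fintype ι] {lam : ℝ} (hlam : 0 < lam)
    (σ : ι → Equiv.Perm (Fin (n + 1))) (m2 : ℝ) (x : Fin (n + 1)) (hσ : ∀ μ, σ μ x ≠ x) :
    gibbsExpect (shiftCoupling σ m2) lam
        (fun φ => latticePhi4Force (shiftCoupling σ m2) lam φ x ^ 2)
      = 2 * (2 * Fintype.card ι + m2)
        + 12 * lam * gibbsExpect (shiftCoupling σ m2) lam (fun φ => φ x ^ 2) := by
  rw [gibbs_score hlam, shiftCoupling_diag σ m2 x hσ]

/-- The two-point identity in the engine's force convention (`latticePhi4Force_shift`):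
`⟨φ_y · (Σ_μ (4φ_x − 2φ(x+μ) − 2φ(x−μ)) + 2m²φ_x + 4λφ_x³)⟩ = δ_{xy}` (`λ > 0`). -/
theorem gibbs_sd_two_point_shift {ι : Type*} [Fintype ι] {lam : ℝ} (hlam : 0 < lam)
    (σ : ι → Equiv.Perm (Fin (n + 1))) (m2 : ℝ) (x y : Fin (n + 1)) :
    gibbsExpect (shiftCoupling σ m2) lam (fun φ => φ y *
        ((∑ μ, (4 * φ x - 2 * φ (σ μ x) - 2 * φ ((σ μ).symm x))) + 2 * m2 * φ x
          + 4 * lam * φ x ^ 3))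
      = if y = x then 1 else 0 := by
  rw [← gibbs_sd_two_point hlam (shiftCoupling σ m2) x y]
  congr 1
  funext φ
  rw [latticePhi4Force_shift]

end Polynomial

end Summit.Ventures.LatticeQCDFlow.Scoring
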